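import Summits.Ventures.CertifiedQuantumChemistry.Certificates.H6Sto6gR1786KernelLowerTables
import HarnessLib

/-!
# Ventures/CertifiedQuantumChemistry — Certificates/H6Sto6gR1786KernelLowerRowsU2.lean: kernel LOWER ROW of `h6Sto6gR1786`, sector `(3,3)` — odd (`B_1u`) block `U`, rows 90–199

HONEST FRAMING (verbatim): certified bounds for a stated model Hamiltonian in a stated basis; not a
claim about the real molecule beyond that model.

var-2 (gen 15), zero compute. Row chunks `90 ≤ i < 199` of the Frobenius-residual feed (`Rows/GramResidualLowerBound.lean`,
`form_bound_of_guardedRows`) for the odd (`B_1u`) block `U` of the `(3,3)` sector of `h6Fast = h6Sto6gR1786`: for each row `i`, the kernel evaluates the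
guarded Slater–Condon elements `⟨D_i|H|D_j⟩` (`j ≥ i`, `≤ 2` replacements; `Rows/CIUpperBound.lean`), the Gram entries `(M Mᵀ)_ij` of the factor
rows (`h6lowUM`, truncating `zipWith`), and decides `T_ii² + 2 Σ_{j>i} T_ij² ≤ u_i` over `ℚ` (`T = 4^12 (H − μ) − M Mᵀ`, `μ = -3455252212565/1099511627776`). See
`Certificates/H6Sto6gR1786KernelLowerTables.lean` for the data and `Certificates/H6Sto6gR1786KernelLower.lean` for the assembly. Each row is its own
`decide +kernel`; ≈ 335 s of kernel work in this file (measured rates: 40 ms per surviving pair, 0.3 ms per factor entry product).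
No claim node; no row asserted here; 0 sorry.
-/

set_option linter.style.longLine false

namespace Summit.Ventures.CertifiedQuantumChemistry

open Matrix Finset
open Literature.MathematicalPhysics.QuantumLattice Literature.MathematicalPhysics.QuantumChemistry
open Summit.Ventures.CertifiedQuantumChemistry.Hamiltonians

namespace Certificates

set_option maxHeartbeats 100000000 in
/-- Block `U`, rows `90 ≤ i < 106` of the Frobenius-residual feed (`Rows/GramResidualLowerBound.lean`):
`T_ii² + 2 Σ_{j>i} T_ij² ≤ u_i` with `T_ij = 4^12 [≤ 2 replacements] ⟨D_i|H|D_j⟩ − 4^12 μ [i=j] − (M Mᵀ)_ij` on the re-tabled model;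
the range is re-indexed by `Fin 16` and each row is its own `decide +kernel` (≈ 69 s of kernel work on the farm). -/
theorem h6lowU_rows_90_106 : ∀ i : Fin 200, 90 ≤ i.val → i.val < 106 →
    ((16777216 : ℚ) * (h6Fast.slaterCondon (pairSet (h6lowA i) (h6lowUB i)) (pairSet (h6lowA i) (h6lowUB i)) - ((-3455252212565 : ℚ) / 1099511627776)) - (((List.zipWith (· * ·) ((h6lowUM i).map fun e : ℕ => if e % 2 = 0 then ((e / 2 : ℕ) : ℤ) else -((e / 2 : ℕ) : ℤ)) ((h6lowUM i).map fun e : ℕ => if e % 2 = 0 then ((e / 2 : ℕ) : ℤ) else -((e / 2 : ℕ) : ℤ))).sum : ℤ) : ℚ)) ^ 2 +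
      2 * (∑ j, if i < j then
        ((16777216 : ℚ) * (if (h6lowA j \ h6lowA i).card + (h6lowUB j \ h6lowUB i).card ≤ 2 then h6Fast.slaterCondon (pairSet (h6lowA i) (h6lowUB i)) (pairSet (h6lowA j) (h6lowUB j)) else 0) - (((List.zipWith (· * ·) ((h6lowUM i).map fun e : ℕ => if e % 2 = 0 then ((e / 2 : ℕ) : ℤ) else -((e / 2 : ℕ) : ℤ)) ((h6lowUM j).map fun e : ℕ => if e % 2 = 0 then ((e / 2 : ℕ) : ℤ) else -((e / 2 : ℕ) : ℤ))).sum : ℤ) : ℚ)) ^ 2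
        else 0) ≤ ((h6lowUu i : ℕ) : ℚ) := by
  intro i ha hb
  obtain ⟨t, rfl⟩ : ∃ t : Fin 16, i = Fin.castLE (by decide) (Fin.natAdd 90 t) :=
    ⟨⟨i.val - 90, by omega⟩, Fin.ext (show i.val = 90 + (i.val - 90) by omega)⟩
  clear ha hb
  fin_cases t <;> decide +kernel

set_option maxHeartbeats 100000000 in
/-- Block `U`, rows `106 ≤ i < 121` of the Frobenius-residual feed (`Rows/GramResidualLowerBound.lean`):
`T_ii² + 2 Σ_{j>i} T_ij² ≤ u_i` with `T_ij = 4^12 [≤ 2 replacements] ⟨D_i|H|D_j⟩ − 4^12 μ [i=j] − (M Mᵀ)_ij` on the re-tabled model;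
the range is re-indexed by `Fin 15` and each row is its own `decide +kernel` (≈ 65 s of kernel work on the farm). -/
theorem h6lowU_rows_106_121 : ∀ i : Fin 200, 106 ≤ i.val → i.val < 121 →
    ((16777216 : ℚ) * (h6Fast.slaterCondon (pairSet (h6lowA i) (h6lowUB i)) (pairSet (h6lowA i) (h6lowUB i)) - ((-3455252212565 : ℚ) / 1099511627776)) - (((List.zipWith (· * ·) ((h6lowUM i).map fun e : ℕ => if e % 2 = 0 then ((e / 2 : ℕ) : ℤ) else -((e / 2 : ℕ) : ℤ)) ((h6lowUM i).map fun e : ℕ => if e % 2 = 0 then ((e / 2 : ℕ) : ℤ) else -((e / 2 : ℕ) : ℤ))).sum : ℤ) : ℚ)) ^ 2 +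
      2 * (∑ j, if i < j then
        ((16777216 : ℚ) * (if (h6lowA j \ h6lowA i).card + (h6lowUB j \ h6lowUB i).card ≤ 2 then h6Fast.slaterCondon (pairSet (h6lowA i) (h6lowUB i)) (pairSet (h6lowA j) (h6lowUB j)) else 0) - (((List.zipWith (· * ·) ((h6lowUM i).map fun e : ℕ => if e % 2 = 0 then ((e / 2 : ℕ) : ℤ) else -((e / 2 : ℕ) : ℤ)) ((h6lowUM j).map fun e : ℕ => if e % 2 = 0 then ((e / 2 : ℕ) : ℤ) else -((e / 2 : ℕ) : ℤ))).sum : ℤ) : ℚ)) ^ 2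
        else 0) ≤ ((h6lowUu i : ℕ) : ℚ) := by
  intro i ha hb
  obtain ⟨t, rfl⟩ : ∃ t : Fin 15, i = Fin.castLE (by decide) (Fin.natAdd 106 t) :=
    ⟨⟨i.val - 106, by omega⟩, Fin.ext (show i.val = 106 + (i.val - 106) by omega)⟩
  clear ha hb
  fin_cases t <;> decide +kernel

set_option maxHeartbeats 100000000 in
/-- Block `U`, rows `121 ≤ i < 138` of the Frobenius-residual feed (`Rows/GramResidualLowerBound.lean`):
`T_ii² + 2 Σ_{j>i} T_ij² ≤ u_i` with `T_ij = 4^12 [≤ 2 replacements] ⟨D_i|H|D_j⟩ − 4^12 μ [i=j] − (M Mᵀ)_ij` on the re-tabled model;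
the range is re-indexed by `Fin 17` and each row is its own `decide +kernel` (≈ 67 s of kernel work on the farm). -/
theorem h6lowU_rows_121_138 : ∀ i : Fin 200, 121 ≤ i.val → i.val < 138 →
    ((16777216 : ℚ) * (h6Fast.slaterCondon (pairSet (h6lowA i) (h6lowUB i)) (pairSet (h6lowA i) (h6lowUB i)) - ((-3455252212565 : ℚ) / 1099511627776)) - (((List.zipWith (· * ·) ((h6lowUM i).map fun e : ℕ => if e % 2 = 0 then ((e / 2 : ℕ) : ℤ) else -((e / 2 : ℕ) : ℤ)) ((h6lowUM i).map fun e : ℕ => if e % 2 = 0 then ((e / 2 : ℕ) : ℤ) else -((e / 2 : ℕ) : ℤ))).sum : ℤ) : ℚ)) ^ 2 +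
      2 * (∑ j, if i < j then
        ((16777216 : ℚ) * (if (h6lowA j \ h6lowA i).card + (h6lowUB j \ h6lowUB i).card ≤ 2 then h6Fast.slaterCondon (pairSet (h6lowA i) (h6lowUB i)) (pairSet (h6lowA j) (h6lowUB j)) else 0) - (((List.zipWith (· * ·) ((h6lowUM i).map fun e : ℕ => if e % 2 = 0 then ((e / 2 : ℕ) : ℤ) else -((e / 2 : ℕ) : ℤ)) ((h6lowUM j).map fun e : ℕ => if e % 2 = 0 then ((e / 2 : ℕ) : ℤ) else -((e / 2 : ℕ) : ℤ))).sum : ℤ) : ℚ)) ^ 2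
        else 0) ≤ ((h6lowUu i : ℕ) : ℚ) := by
  intro i ha hb
  obtain ⟨t, rfl⟩ : ∃ t : Fin 17, i = Fin.castLE (by decide) (Fin.natAdd 121 t) :=
    ⟨⟨i.val - 121, by omega⟩, Fin.ext (show i.val = 121 + (i.val - 121) by omega)⟩
  clear ha hb
  fin_cases t <;> decide +kernel

set_option maxHeartbeats 100000000 in
/-- Block `U`, rows `138 ≤ i < 159` of the Frobenius-residual feed (`Rows/GramResidualLowerBound.lean`):
`T_ii² + 2 Σ_{j>i} T_ij² ≤ u_i` with `T_ij = 4^12 [≤ 2 replacements] ⟨D_i|H|D_j⟩ − 4^12 μ [i=j] − (M Mᵀ)_ij` on the re-tabled model;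
the range is re-indexed by `Fin 21` and each row is its own `decide +kernel` (≈ 67 s of kernel work on the farm). -/
theorem h6lowU_rows_138_159 : ∀ i : Fin 200, 138 ≤ i.val → i.val < 159 →
    ((16777216 : ℚ) * (h6Fast.slaterCondon (pairSet (h6lowA i) (h6lowUB i)) (pairSet (h6lowA i) (h6lowUB i)) - ((-3455252212565 : ℚ) / 1099511627776)) - (((List.zipWith (· * ·) ((h6lowUM i).map fun e : ℕ => if e % 2 = 0 then ((e / 2 : ℕ) : ℤ) else -((e / 2 : ℕ) : ℤ)) ((h6lowUM i).map fun e : ℕ => if e % 2 = 0 then ((e / 2 : ℕ) : ℤ) else -((e / 2 : ℕ) : ℤ))).sum : ℤ) : ℚ)) ^ 2 +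
      2 * (∑ j, if i < j then
        ((16777216 : ℚ) * (if (h6lowA j \ h6lowA i).card + (h6lowUB j \ h6lowUB i).card ≤ 2 then h6Fast.slaterCondon (pairSet (h6lowA i) (h6lowUB i)) (pairSet (h6lowA j) (h6lowUB j)) else 0) - (((List.zipWith (· * ·) ((h6lowUM i).map fun e : ℕ => if e % 2 = 0 then ((e / 2 : ℕ) : ℤ) else -((e / 2 : ℕ) : ℤ)) ((h6lowUM j).map fun e : ℕ => if e % 2 = 0 then ((e / 2 : ℕ) : ℤ) else -((e / 2 : ℕ) : ℤ))).sum : ℤ) : ℚ)) ^ 2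
        else 0) ≤ ((h6lowUu i : ℕ) : ℚ) := by
  intro i ha hb
  obtain ⟨t, rfl⟩ : ∃ t : Fin 21, i = Fin.castLE (by decide) (Fin.natAdd 138 t) :=
    ⟨⟨i.val - 138, by omega⟩, Fin.ext (show i.val = 138 + (i.val - 138) by omega)⟩
  clear ha hb
  fin_cases t <;> decide +kernel

set_option maxHeartbeats 100000000 in
/-- Block `U`, rows `159 ≤ i < 200` of the Frobenius-residual feed (`Rows/GramResidualLowerBound.lean`):
`T_ii² + 2 Σ_{j>i} T_ij² ≤ u_i` with `T_ij = 4^12 [≤ 2 replacements] ⟨D_i|H|D_j⟩ − 4^12 μ [i=j] − (M Mᵀ)_ij` on the re-tabled model;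
the range is re-indexed by `Fin 41` and each row is its own `decide +kernel` (≈ 67 s of kernel work on the farm). -/
theorem h6lowU_rows_159_200 : ∀ i : Fin 200, 159 ≤ i.val → i.val < 200 →
    ((16777216 : ℚ) * (h6Fast.slaterCondon (pairSet (h6lowA i) (h6lowUB i)) (pairSet (h6lowA i) (h6lowUB i)) - ((-3455252212565 : ℚ) / 1099511627776)) - (((List.zipWith (· * ·) ((h6lowUM i).map fun e : ℕ => if e % 2 = 0 then ((e / 2 : ℕ) : ℤ) else -((e / 2 : ℕ) : ℤ)) ((h6lowUM i).map fun e : ℕ => if e % 2 = 0 then ((e / 2 : ℕ) : ℤ) else -((e / 2 : ℕ) : ℤ))).sum : ℤ) : ℚ)) ^ 2 +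
      2 * (∑ j, if i < j then
        ((16777216 : ℚ) * (if (h6lowA j \ h6lowA i).card + (h6lowUB j \ h6lowUB i).card ≤ 2 then h6Fast.slaterCondon (pairSet (h6lowA i) (h6lowUB i)) (pairSet (h6lowA j) (h6lowUB j)) else 0) - (((List.zipWith (· * ·) ((h6lowUM i).map fun e : ℕ => if e % 2 = 0 then ((e / 2 : ℕ) : ℤ) else -((e / 2 : ℕ) : ℤ)) ((h6lowUM j).map fun e : ℕ => if e % 2 = 0 then ((e / 2 : ℕ) : ℤ) else -((e / 2 : ℕ) : ℤ))).sum : ℤ) : ℚ)) ^ 2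
        else 0) ≤ ((h6lowUu i : ℕ) : ℚ) := by
  intro i ha hb
  obtain ⟨t, rfl⟩ : ∃ t : Fin 41, i = Fin.castLE (by decide) (Fin.natAdd 159 t) :=
    ⟨⟨i.val - 159, by omega⟩, Fin.ext (show i.val = 159 + (i.val - 159) by omega)⟩
  clear ha hb
  fin_cases t <;> decide +kernel

end Certificates

end Summit.Ventures.CertifiedQuantumChemistry
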